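import Literature.MathematicalPhysics.QuantumFieldTheory.Balaban1983to89.B9Thm311PosDefNearFlatZd

/-!
# `Balaban1983to89.B9Thm311PosDefOpenRegimeZd` — [Balaban1985BackgroundPropagators] THEOREM 3.11's CONCLUSION IS STABLE IN THE REGIME: at every cube member,
# the set of backgrounds `U₀` of the class (1.7) on `ℤᵈ` at which the genuine `Δ_a(U₀)` is positive definite on `E_𝔤(□₀)` is RELATIVELY OPEN in that class —
# the four letters of `Δ_a(U₀)` are continuous in the background at EVERY point of the regime (not only at `U₀ = 1`), because [Balaban1985Averaging] Prop. 2
# keeps all averaged configurations `Ū₀ʲ`, `j ≤ m`, inside the disc of the logarithm series (21)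

statement-level skeleton of published theorems with citation tags; proofs where landed; nothing here is a claim about the
Yang–Mills mass gap

`[Balaban1985BackgroundPropagators]` ("B9", CMP **99** (1985) 389–434) p. 416, Theorem 3.11 (*«… the operators Δ′_a, G′, (Q′G′²Q′*)⁻¹, Δ_a, G are positive
definite»*), p. 400 Thm 3.4 (the propagators depend analytically — here: continuously — on the background); `[Balaban1985Averaging]` ("[5]", CMP **98**)
Prop. 2 (52)–(54) p. 26: *«If U satisfies (52) … then |Ūʲ(∂p) − 1| < α₀ + 2C₀α₀² < 2α₀»* and p. 25: *«|V(Γ_{c,x})V(c)⁻¹ − 1| < … = O(1)L²α₀»* — so at every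
background of the class (1.7) on `ℤᵈ` (window `α_Q∕L²`) every loop variable of every `Ū₀ʲ`, `j ≤ m`, is within `1∕(32L²) < 1` of `1`.  PDF held:
`paper:balaban1985-cmp98-averaging` pp. 25–26; `paper:balaban1985-cmp99-background-propagators` p. 416 (re-read by this seat, 2026-08-28).

CITATION HEADER (lean-in-tree rule).  Cell `pub-ymgap` (YM Track A, HUMAN RULING D-0062 ∕ D-0149 width push), DAG node N06 = [B9], width seat
`pub-ymgap-dag-n06-w4` (g3), FILE 7 of the IDEA-3.11 STEP (ii) road (FILEs 1–6: `B9Thm311PosDefOpenZd` p605686, `B9Eq310DeltaPrimeContinuityZd` p606545,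
`B7Eq43AveragingContinuity` p606675, `B9Eq325ProjFormulaZdLevels` p608190, `B9Eq325ProjContinuityZd` p608634, `B9Thm311PosDefNearFlatZd`).  FILE 6 proved the
letters continuous within the regime AT `U₀ = 1` (where the disc condition of [5] (21) is free); THIS FILE proves the disc condition at EVERY background of
dag-n06-w2 g3's regime set `𝒰′ = {U₀ unitary, (1.7) on ℤᵈ up to level m, window α_Q∕L²}` ([5] Prop. 2 + p. 25, `B7Prop2Explicit.prop2_explicit_lt_two` ∕
`norm_Wcx_sub_one_le` BY NAME), hence continuity of the letters within `𝒰′` at every `U₁ ∈ 𝒰′`, hence (FILE 1's engine) RELATIVE OPENNESS of positivity.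

WHAT IS PROVED (kernel, 0 sorry; theorems only — no `def`, `instance`, `notation`).
* §1 `pdev_le_of_reg17UnivP` (the class (1.7) on `ℤᵈ` at level `m` bounds the plaquette deviation: `pdev U₀ ≤ (α_Q∕L²)L^{−2m}`), ★★ `wcx_avgIter_lt_one_of_reg17UnivP`
  (for `U₀ ∈ 𝒰′`, every `j ≤ m` and every block: `‖Ū₀ʲ(Γ_{c,x})Ū₀ʲ(c)⁻¹ − 1‖ < 1` — in fact `≤ 1∕(32L²)`).
* §2 ★★ `continuousWithinAt_QQZdP_of_mem` (the `Q*aQ` letter is continuous within `𝒰′`-type sets at every point satisfying the disc condition),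
  ★★★ `lettersContinuousWithinAt_opsAllZd_of_mem` (all four letters, any member with finite `Ω₀`, finite level-`m` constraint sets, `Q′*` injective everywhere:
  `LettersContinuousWithinAt … 𝒰 U₁` at EVERY `U₁ ∈ 𝒰` of a set `𝒰 ⊆` {unitary} ∩ (1.7)(i.Ω) ∩ {`Ū₀ʲ` unitary, `j ≤ m`} ∩ {disc condition}).
* §3 (cube members, class `cubeLamBP`, `m ≤ k`, `d, L ≥ 2`, `L ≤ ρ`) ★★★ `lettersContinuousWithinAt_opsAllZd_cube_reg17UnivP` (at every `U₁ ∈ 𝒰′`),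
  ★★★★ `bondPair_pos_eventually_of_pos_reg17UnivP` — **RELATIVE OPENNESS**: if `⟨A, Δ_a(U₁)A⟩_τ > 0` on `E_𝔤(□₀)∖0` at some `U₁ ∈ 𝒰′`, then the same holds for
  all `U₀ ∈ 𝒰′` near `U₁`; ★★★ `regularAtH_eventually_of_pos_reg17UnivP` (then `Δ_a(U₀)↾□₀` is invertible on `E_𝔤(□₀)` for all `U₀ ∈ 𝒰′` near `U₁`).

HONEST SCOPE.  Stability (openness) of print's conclusion along the regime; NOT the conclusion itself away from a neighbourhood of a positive background
(FILE 6 gives it near `U₀ = 1`); print's Theorem 3.11 asserts positivity on ALL of (3.35) uniformly (Sects. B–E) — not proved here.  Count-neutral; N05 ∕ N06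
NOT discharged; K1⁷ `stmt-QuantumFields-20542` NOT closed; one finite `𝕋⁴` programme at fixed `ε`, Bałaban as printed; R4 closes only the conditional
finite-`𝕋⁴` rung `BalabanLadder.UV` — nothing continuum ∕ ℝ⁴ ∕ OS ∕ mass gap ∕ Clay.  Unit `pub-ymgap-dag-n06-w4` (g3), 2026-08-28.
-/

noncomputable section

namespace Literature.MathematicalPhysics.QuantumFieldTheory.Balaban1983to89.B9Thm311PosDefOpenRegimeZd

open Filter Topology
open B7Prop1Explicit
open B7Prop2Explicit (unitaryUnits avgIter pdev le_pdev avgIter_mem avgClosed_unitaryUnits unitaryUnits_le_U1 hol_plaqWord_self prop2_explicit_lt_two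
  norm_Wcx_sub_one_le C0 c2' C0_pos)
open B8Eq119TwistedAxial (bgT)
open B8Ineq132 (BondTouches)
open B8LeafModelZd (ZdIdx)
open B8Eq155JBound (Jcur)
open B9SupplySockB9P3ZdLetters (OpsZd deltaAOf)
open B9SupplySockB9P3ZdAllLettersZd (opsAllZd opsAllZd_Dp opsAllZd_QQ opsAllZd_DRDs)
open B9Eq316AveragingTransposeZd (Reg17 alphaQ alphaQ_pos C0_mul_alphaQ_le four_mul_alphaQ_le wQ linCovIterT clsField)
open B9Eq316AveragingTransposeZdPrinted (QQZdP withQQP)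
open B9Eq369CurvSmallZd (DpZd)
open B9SupplySockB9P3ZdGammaInAkDpZd (withDpZd)
open B9Eq321LandauProjectionZd (opsLandau)
open B9Eq325QGGQInvZd (QprimeStarInjective)
open B9Eq327GreenZd (domSub bondPair LinearOnDomAt)
open B9Eq327GreenZdHerm (domSubH domSubH_le mem_domSubH_iff HermPreservingAt RegularAtH regularAtH_of_bondPair_pos)
open B9Thm311PosDefOpenZd (LettersContinuousWithinAt bondPair_pos_eventually_domSubH cubeMember_Ω0_finite)
open B9Eq310DeltaPrimeContinuityZd (continuousWithinAt_Jcur_add_DpZd)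
open B9Eq325ProjContinuityZd (continuousAt_bgT continuousAt_DRDs_opsLandau)
open B9Thm311PosDefNearFlatZd (continuousAt_QQZdP_branch reg17_of_univ bgT_mem_unitaryUnits_of_reg17UnivP qprimeStarInjective_cubeMember)
open B9Eq326DeltaAHermitianZdCurved (linear_herm_on_reg17UnivP)
open B8Eq131CubesAdmissible (cubeFam)
open B8CubeMemberZd (cubeLamS)
open B8Ineq159FlatCubeMemberPrinted (cubeLamBP)
open B8Eq191FlatLettersCubeMember (cubeLamS_finite)

-- `Site` alone could resolve to the torus sites of `Setup.lean`; re-export the `ℤ^d` sites of `B7Prop1Explicit`.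
export B7Prop1Explicit (Site)

variable {d : ℕ} {𝔸 : Type*} [CStarAlgebra 𝔸] [FiniteDimensional ℝ 𝔸] [Nontrivial 𝔸] {L : ℕ}

/-! ## §1  [5] Prop. 2 + p. 25: in the class (1.7) on `ℤᵈ` every loop variable of every `Ū₀ʲ`, `j ≤ m`, is in the disc of the series (21) -/

section Disc

omit [FiniteDimensional ℝ 𝔸] [Nontrivial 𝔸] in
/-- **the class (1.7) on `ℤᵈ` at level `m` bounds the plaquette deviation**: `pdev U₀ ≤ (α_Q∕L²)·L^{−2m}` (`d > 0`).
[cite: Balaban1985RegularSpaces, (1.7) p.77; Balaban1985Averaging, (52) p.26] -/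
theorem pdev_le_of_reg17UnivP (hd : 0 < d) (hL : 1 ≤ L) (m : ℕ) {U₀ : Site d → Fin d → 𝔸ˣ}
    (hreg : Reg17 L m (fun _ => (Set.univ : Set (Site d))) (alphaQ d L / (L : ℝ) ^ 2) U₀) :
    pdev U₀ ≤ alphaQ d L / (L : ℝ) ^ 2 * (((L : ℝ) ^ m)⁻¹) ^ 2 := by
  haveI : Nonempty (Site d × Fin d × Fin d) := ⟨(0, ⟨0, hd⟩, ⟨0, hd⟩)⟩
  have hαQ : 0 < alphaQ d L := alphaQ_pos d hL
  refine ciSup_le fun p => ?_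
  rcases p with ⟨x, μ, ν⟩
  by_cases hμν : μ = ν
  · subst hμν
    rw [hol_plaqWord_self, Units.val_one, sub_self, norm_zero]
    positivity
  · exact (hreg m le_rfl x μ ν hμν (Or.inl (Set.mem_univ _))).le

omit [FiniteDimensional ℝ 𝔸] in
/-- ★★ **IN THE CLASS (1.7) ON `ℤᵈ` EVERY LOOP VARIABLE OF EVERY AVERAGE `Ū₀ʲ`, `j ≤ m`, IS IN THE DISC OF (21)**: for `U₀` unitary with (1.7) on `ℤᵈ` up to
level `m` at window `α_Q∕L²` (`L ≥ 2`, `d > 0`), `‖Ū₀ʲ(Γ_{c,x})Ū₀ʲ(c)⁻¹ − 1‖ < 1` for every `L`-bond `c` and `x ∈ B(c₋)` — by [5] Prop. 2 (54) at level `j`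
(`pdev Ū₀ʲ < 4α_Q∕L²`) and the p. 25 estimate `|V(Γ_{c,x})V(c)⁻¹ − 1| ≤ 16(d+1)(d+4)L²·(sup_p|V(∂p) − 1|)`, the product being `≤ 1∕(32L²)`.
[cite: Balaban1985Averaging, Prop. 2 (52)–(54) p.26, p.25 (displays before (47)); Balaban1985RegularSpaces, (1.7) p.77] -/
theorem wcx_avgIter_lt_one_of_reg17UnivP (hd : 0 < d) (hL : 2 ≤ L) (m : ℕ) {U₀ : Site d → Fin d → 𝔸ˣ}
    (hU : ∀ (x : Site d) (κ : Fin d), U₀ x κ ∈ unitaryUnits 𝔸)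
    (hreg : Reg17 L m (fun _ => (Set.univ : Set (Site d))) (alphaQ d L / (L : ℝ) ^ 2) U₀) :
    ∀ j, j ≤ m → ∀ (q : Site d) (κ : Fin d) (r : Fin d → Fin L), ‖((Wcx L (avgIter L U₀ j) q κ (boxVec L r) : 𝔸ˣ) : 𝔸) - 1‖ < 1 := by
  intro j hj q κ r
  have hL1 : 1 ≤ L := le_trans one_le_two hL
  have hLr : (2 : ℝ) ≤ L := by exact_mod_cast hL
  have hL0 : (0 : ℝ) < L := by linarith
  have hαQ : 0 < alphaQ d L := alphaQ_pos d hL1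
  have hL2 : (4 : ℝ) ≤ (L : ℝ) ^ 2 := by nlinarith
  set β : ℝ := alphaQ d L / (L : ℝ) ^ 2 with hβ
  have hβpos : 0 < β := div_pos hαQ (by positivity)
  have hβle : β ≤ alphaQ d L / 4 := by
    rw [hβ]
    exact div_le_div_of_nonneg_left hαQ.le (by norm_num) hL2
  -- the Prop.-2 window for `α₀ := 2β`
  have hα : 0 < 2 * β := by positivity
  have hα3 : C0 d * (2 * β) ≤ 1 / 3 := by
    have h1 := C0_mul_alphaQ_le d L
    have hC := (C0_pos d).le
    nlinarith [mul_le_mul_of_nonneg_left hβle hC]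
  have hc4 : 4 * alphaQ d L ≤ c2' d L := four_mul_alphaQ_le d L
  have hα2 : 2 * (2 * β) ≤ c2' d L := by linarith
  -- (52) at level `j`
  have hpdev := pdev_le_of_reg17UnivP (L := L) hd hL1 m hreg
  have hLj : (((L : ℝ) ^ m)⁻¹) ^ 2 ≤ (((L : ℝ) ^ j)⁻¹) ^ 2 := by
    have h1 : (L : ℝ) ^ j ≤ (L : ℝ) ^ m := pow_le_pow_right₀ (by linarith) hj
    have h2 : 0 < (L : ℝ) ^ j := by positivity
    have h3 : ((L : ℝ) ^ m)⁻¹ ≤ ((L : ℝ) ^ j)⁻¹ := inv_anti₀ h2 h1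
    exact pow_le_pow_left₀ (by positivity) h3 2
  have h52 : pdev U₀ < 2 * β * (((L : ℝ) ^ j)⁻¹) ^ 2 := by
    have hpos : 0 < β * (((L : ℝ) ^ j)⁻¹) ^ 2 := by positivity
    calc pdev U₀ ≤ β * (((L : ℝ) ^ m)⁻¹) ^ 2 := hpdev
      _ ≤ β * (((L : ℝ) ^ j)⁻¹) ^ 2 := mul_le_mul_of_nonneg_left hLj hβpos.le
      _ < 2 * β * (((L : ℝ) ^ j)⁻¹) ^ 2 := by linarith
  -- (54) at level `j`: `pdev Ū₀ʲ < 4β`, and `Ū₀ʲ` unitary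
  have h54 : pdev (avgIter L U₀ j) < 2 * (2 * β) := prop2_explicit_lt_two L hL (avgClosed_unitaryUnits d L) j U₀ hU hα hα3 hα2 h52
  have hmem : ∀ (x : Site d) (κ' : Fin d), avgIter L U₀ j x κ' ∈ unitaryUnits 𝔸 :=
    avgIter_mem L hL (avgClosed_unitaryUnits d L) j U₀ hU hα hα3 hα2 h52 j le_rfl
  have hU1 : ∀ (x : Site d) (κ' : Fin d), avgIter L U₀ j x κ' ∈ B7Prop1Explicit.U1 𝔸 := fun x κ' => unitaryUnits_le_U1 (hmem x κ')
  -- p. 25 at `α₀ := 4β`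
  have hsmall : 512 * ((d : ℝ) + 1) * ((d : ℝ) + 4) * (L : ℝ) ^ 2 * (4 * β) ≤ 1 := by
    have hc : c2' d L = 1 / (512 * ((d : ℝ) + 1) * (d + 4) * (L : ℝ) ^ 2) := rfl
    have hP : 0 < 512 * ((d : ℝ) + 1) * ((d : ℝ) + 4) * (L : ℝ) ^ 2 := by positivity
    have h4β : 4 * β ≤ c2' d L := by linarith
    calc 512 * ((d : ℝ) + 1) * ((d : ℝ) + 4) * (L : ℝ) ^ 2 * (4 * β)
        ≤ 512 * ((d : ℝ) + 1) * ((d : ℝ) + 4) * (L : ℝ) ^ 2 * c2' d L := mul_le_mul_of_nonneg_left h4β hP.le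
      _ = 1 := by rw [hc]; field_simp
  have h44 : ∀ (x : Site d) (κ₁ κ₂ : Fin d), κ₁ ≠ κ₂ → ‖((hol (avgIter L U₀ j) x (plaqWord κ₁ κ₂) : 𝔸ˣ) : 𝔸) - 1‖ ≤ 4 * β := by
    intro x κ₁ κ₂ _
    have := le_pdev hU1 x κ₁ κ₂
    linarith
  have hW := norm_Wcx_sub_one_le L hL1 (avgIter L U₀ j) hU1 (by positivity : (0 : ℝ) ≤ 4 * β) hsmall h44 q κ r
  -- the product is `≤ 1∕(32L²) < 1`
  have hfin : 2 * (8 * ((d : ℝ) + 1) * ((d : ℝ) + 4) * (L : ℝ) ^ 2 * (4 * β)) < 1 := by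
    have hc : c2' d L = 1 / (512 * ((d : ℝ) + 1) * (d + 4) * (L : ℝ) ^ 2) := rfl
    have hP : 0 < ((d : ℝ) + 1) * ((d : ℝ) + 4) := by positivity
    have h4β : 4 * β ≤ c2' d L := by linarith
    have h1 : 2 * (8 * ((d : ℝ) + 1) * ((d : ℝ) + 4) * (L : ℝ) ^ 2 * (4 * β)) ≤ 16 * ((d : ℝ) + 1) * ((d : ℝ) + 4) * (L : ℝ) ^ 2 * c2' d L := by
      nlinarith [mul_le_mul_of_nonneg_left h4β (by positivity : (0 : ℝ) ≤ 16 * ((d : ℝ) + 1) * ((d : ℝ) + 4) * (L : ℝ) ^ 2)]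
    have h2 : 16 * ((d : ℝ) + 1) * ((d : ℝ) + 4) * (L : ℝ) ^ 2 * c2' d L = 1 / 32 := by
      rw [hc]; field_simp; ring
    linarith
  exact lt_of_le_of_lt hW hfin

end Disc

/-! ## §2  All four letters are continuous within the regime at EVERY base point satisfying the disc condition -/

section Letters

variable (τ : 𝔸 →ₗ[ℂ] ℂ) (hτp : ∀ a : 𝔸, a ≠ 0 → 0 < (τ (star a * a)).re)
  (hτt : ∀ a b : 𝔸, τ (a * b) = τ (b * a)) (hτs : ∀ a : 𝔸, τ (star a) = starRingEnd ℂ (τ a))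

/-- ★★ **THE `Q*aQ` LETTER IS CONTINUOUS WITHIN THE REGIME AT EVERY REGIME POINT IN THE DISC**: on a set `𝒰` of (1.7)-backgrounds of the member (`Reg17 L m i.Ω
(α_Q∕L²)`), at a point `U₁ ∈ 𝒰` whose averages `Ū₁ⁱ`, `i < m`, have loop variables in the disc of (21), `U₀ ↦ (Q*aQ(U₀)A)(b)` is continuous within `𝒰` at
`U₁`. [cite: Balaban1985BackgroundPropagators, (3.16) p.393; Balaban1985RegularSpaces, (1.7) p.77] -/
theorem continuousWithinAt_QQZdP_of_mem (ΛbP : ℕ → ℕ → Set (Site d × Fin d)) (i : ZdIdx d L) (m : ℕ) {𝒰 : Set (Site d → Fin d → 𝔸ˣ)}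
    (hreg : ∀ U₀ ∈ 𝒰, Reg17 L m i.Ω (alphaQ d L / (L : ℝ) ^ 2) U₀) {U₁ : Site d → Fin d → 𝔸ˣ} (hU₁ : U₁ ∈ 𝒰)
    (hsmall : ∀ i', i' < m → ∀ (q : Site d) (κ : Fin d) (r : Fin d → Fin L), ‖((Wcx L (avgIter L U₁ i') q κ (boxVec L r) : 𝔸ˣ) : 𝔸) - 1‖ < 1)
    (A : Site d → Fin d → 𝔸) (y : Site d) (μ : Fin d) :
    ContinuousWithinAt (fun U₀ => QQZdP τ L ΛbP i m U₀ A y μ) 𝒰 U₁ := by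
  have hb : ContinuousAt (fun U₀ : Site d → Fin d → 𝔸ˣ =>
      ∑ j ∈ Finset.range (m + 1), (wQ (d := d) L i.η j) • linCovIterT τ L U₀ j (clsField L ΛbP i.η m j U₀ A) y μ) U₁ :=
    continuousAt_QQZdP_branch τ L continuousAt_id ΛbP i m hsmall A y μ
  refine (hb.continuousWithinAt (s := 𝒰)).congr (fun U₀ hU₀ => ?_) ?_
  · show QQZdP τ L ΛbP i m U₀ A y μ = _
    unfold QQZdP
    rw [if_pos (hreg U₀ hU₀)]
  · show QQZdP τ L ΛbP i m U₁ A y μ = _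
    unfold QQZdP
    rw [if_pos (hreg U₁ hU₁)]

include hτt hτs in
/-- ★★★ **ALL FOUR LETTERS OF THE GENUINE `Δ_a(U₀)` ARE CONTINUOUS WITHIN THE REGIME AT EVERY BASE POINT IN THE DISC, ON HERMITIAN FIELDS.**  Member data: `Ω₀ = i.Ω 0`
finite, finite level-`m` constraint sets `i.Λs m j = Λ_j`, `Q′*` injective at every background, `0 < d`, tracial Hermitian faithful `τ`; a set `𝒰` of unitary
backgrounds in the class (1.7) of the member with `Ū₀ʲ` unitary (`j ≤ m`); a base point `U₁ ∈ 𝒰` whose averages `Ū₁ⁱ`, `i ≤ m`, have loop variables in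
the disc of (21). [cite: Balaban1985BackgroundPropagators, (3.26) p.395, (3.10) p.392, (3.16) p.393, (3.20)–(3.25) p.394; Balaban1985RegularSpaces, (1.7) p.77] -/
theorem lettersContinuousWithinAt_opsAllZd_of_mem (ΛbP : ℕ → ℕ → Set (Site d × Fin d)) (ops₀ : ℝ → ZdIdx d L → ℕ → OpsZd d 𝔸) (M : ℝ)
    (i : ZdIdx d L) (m : ℕ) (hΩ : (i.Ω 0).Finite) {Λ : ℕ → Finset (Site d)} (hΛ : i.Λs m = fun j => (↑(Λ j) : Set (Site d))) (hd : 0 < d)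
    (hinj : ∀ U₀ : Site d → Fin d → 𝔸ˣ, QprimeStarInjective L U₀ τ hτp m Λ hΩ.toFinset)
    {𝒰 : Set (Site d → Fin d → 𝔸ˣ)} (hunit : ∀ U₀ ∈ 𝒰, ∀ (x : Site d) (κ : Fin d), U₀ x κ ∈ unitaryUnits 𝔸)
    (hreg : ∀ U₀ ∈ 𝒰, Reg17 L m i.Ω (alphaQ d L / (L : ℝ) ^ 2) U₀)
    (hT : ∀ U₀ ∈ 𝒰, ∀ j, j ≤ m → ∀ (x y : Site d), bgT L U₀ j x y ∈ unitaryUnits 𝔸)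
    {U₁ : Site d → Fin d → 𝔸ˣ} (hU₁ : U₁ ∈ 𝒰)
    (hsmall : ∀ i', i' ≤ m → ∀ (q : Site d) (κ : Fin d) (r : Fin d → Fin L), ‖((Wcx L (avgIter L U₁ i') q κ (boxVec L r) : 𝔸ˣ) : 𝔸) - 1‖ < 1) :
    LettersContinuousWithinAt i.η (opsAllZd τ L ΛbP ops₀ M i m) (i.Ω 0) (domSubH (i.Ω 0)) 𝒰 U₁ := by
  intro A hA y μ _
  have hAh : ∀ (w : Site d) (κ : Fin d), IsSelfAdjoint (A w κ) := ((mem_domSubH_iff (i.Ω 0) A).1 hA).2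
  have h3 : ContinuousWithinAt (fun U₀ => (opsLandau τ (withDpZd (withQQP τ L ΛbP ops₀)) M i m).DRDs U₀ A y μ) 𝒰 U₁ := by
    rw [continuousWithinAt_iff_continuousAt_restrict _ hU₁]
    have hval : ContinuousAt (fun z : 𝒰 => (z : Site d → Fin d → 𝔸ˣ)) ⟨U₁, hU₁⟩ := continuous_subtype_val.continuousAt
    have hbgT : ∀ j, j < m + 1 → ∀ (y' x' : Site d), ContinuousAt (fun z : 𝒰 => bgT L (z : Site d → Fin d → 𝔸ˣ) j y' x') ⟨U₁, hU₁⟩ := by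
      intro j hj y' x'
      refine continuousAt_bgT L hval j (fun i' hi' q κ r => ?_) y' x'
      show ‖((Wcx L (avgIter L U₁ i') q κ (boxVec L r) : 𝔸ˣ) : 𝔸) - 1‖ < 1
      exact hsmall i' (by omega) q κ r
    exact continuousAt_DRDs_opsLandau τ hτp hτt hτs (withDpZd (withQQP τ L ΛbP ops₀)) M i m hΩ hΛ hval hbgT hd (fun z => hunit z.1 z.2)
      (fun z => hinj z.1) (fun z => hT z.1 z.2) hAh y μ
  have h4 := continuousWithinAt_QQZdP_of_mem τ ΛbP i m hreg hU₁ (fun i' hi' => hsmall i' hi'.le) A y μ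
  have h12 := continuousWithinAt_Jcur_add_DpZd i.η A y μ 𝒰 U₁
  have h := (h12.add h3).add h4
  refine h.congr (fun U₀ _ => ?_) ?_ <;>
    simp only [deltaAOf, opsAllZd_Dp, opsAllZd_DRDs, opsAllZd_QQ, Pi.add_apply]

end Letters

/-! ## §3  Cube members: relative openness of Theorem 3.11's conclusion along the regime -/

section Cube

variable (τ : 𝔸 →ₗ[ℂ] ℂ) (hτp : ∀ a : 𝔸, a ≠ 0 → 0 < (τ (star a * a)).re)
  (hτt : ∀ a b : 𝔸, τ (a * b) = τ (b * a)) (hτs : ∀ a : 𝔸, τ (star a) = starRingEnd ℂ (τ a))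

include hτp hτt hτs in
/-- ★★★ **AT EVERY CUBE MEMBER, ALL FOUR LETTERS ARE CONTINUOUS WITHIN `𝒰′` AT EVERY `U₁ ∈ 𝒰′`** (`𝒰′` = unitary backgrounds in the class (1.7) on `ℤᵈ` up to
level `m` at window `α_Q∕L²`; `Ω = cubeFam false`, `Λs = cubeLamS`, any class `ΛbP`, `m ≤ k`, `d, L ≥ 2`, `L ≤ ρ`). [cite: Balaban1985BackgroundPropagators, (3.26) p.395, Thm 3.11 p.416; Balaban1985Averaging, Prop. 2 p.26; Balaban1985RegularSpaces, (1.7) p.77, (1.131) p.99] -/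
theorem lettersContinuousWithinAt_opsAllZd_cube_reg17UnivP [NeZero L] (hd2 : 2 ≤ d) (hL2 : 2 ≤ L) (ΛbP : ℕ → ℕ → Set (Site d × Fin d))
    (ops₀ : ℝ → ZdIdx d L → ℕ → OpsZd d 𝔸) (M : ℝ) (i : ZdIdx d L) {a : Site d} {Mc ρ : ℕ} (hΩ : i.Ω = cubeFam false L a Mc ρ i.k)
    (hΛs : i.Λs = cubeLamS L a Mc ρ i.k) (hρ : L ≤ ρ) {m : ℕ} (hm : m ≤ i.k) {U₁ : Site d → Fin d → 𝔸ˣ}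
    (hU₁ : U₁ ∈ {U₀ : Site d → Fin d → 𝔸ˣ | (∀ x κ, U₀ x κ ∈ unitaryUnits 𝔸) ∧
        Reg17 L m (fun _ => (Set.univ : Set (Site d))) (alphaQ d L / (L : ℝ) ^ 2) U₀}) :
    LettersContinuousWithinAt i.η (opsAllZd τ L ΛbP ops₀ M i m) (i.Ω 0) (domSubH (i.Ω 0))
      {U₀ : Site d → Fin d → 𝔸ˣ | (∀ x κ, U₀ x κ ∈ unitaryUnits 𝔸) ∧
        Reg17 L m (fun _ => (Set.univ : Set (Site d))) (alphaQ d L / (L : ℝ) ^ 2) U₀} U₁ := by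
  have hd : 0 < d := lt_of_lt_of_le zero_lt_two hd2
  have hΛ : i.Λs m = fun j => (↑((cubeLamS_finite L a Mc ρ i.k m j).toFinset) : Set (Site d)) := by
    funext j
    simp only [Set.Finite.coe_toFinset, hΛs]
  exact lettersContinuousWithinAt_opsAllZd_of_mem τ hτp hτt hτs ΛbP ops₀ M i m (cubeMember_Ω0_finite i hΩ) hΛ hd
    (qprimeStarInjective_cubeMember τ hτp hτs i hΩ hρ hm) (fun U₀ hU => hU.1) (fun U₀ hU => reg17_of_univ hU.2)
    (fun U₀ hU => bgT_mem_unitaryUnits_of_reg17UnivP hd hL2 m hU.1 hU.2) hU₁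
    (wcx_avgIter_lt_one_of_reg17UnivP hd hL2 m hU₁.1 hU₁.2)

include hτp hτt hτs in
/-- ★★★★ **RELATIVE OPENNESS OF THEOREM 3.11's CONCLUSION ALONG THE REGIME**: at a cube member (class `cubeLamBP`, `m ≤ k`, `d, L ≥ 2`, `L ≤ ρ`), if at some
`U₁ ∈ 𝒰′` the genuine `Δ_a(U₁)` is positive definite on the Hermitian fields of `E(□₀)` — `0 < ⟨A, Δ_a(U₁)A⟩_τ` for all Hermitian `0 ≠ A ∈ E(□₀)` —, then the
same holds at ALL `U₀ ∈ 𝒰′` NEAR `U₁`: the positivity set is open in `𝒰′` (FILE 1's engine at the base point `U₁`, the continuity of this file, dag-n06-w2 g3's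
ℝ-linearity on `𝒰′`). [cite: Balaban1985BackgroundPropagators, Thm 3.11 p.416, (3.26) p.395, Thm 3.4 p.400; Balaban1985RegularSpaces, (1.7) p.77, (1.131) p.99] -/
theorem bondPair_pos_eventually_of_pos_reg17UnivP [NeZero L] (hd2 : 2 ≤ d) (hL2 : 2 ≤ L) (ops₀ : ℝ → ZdIdx d L → ℕ → OpsZd d 𝔸) (M : ℝ)
    (i : ZdIdx d L) {a : Site d} {Mc ρ : ℕ} (hΩ : i.Ω = cubeFam false L a Mc ρ i.k) (hΛs : i.Λs = cubeLamS L a Mc ρ i.k) (hρ : L ≤ ρ)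
    {m : ℕ} (hm : m ≤ i.k) {U₁ : Site d → Fin d → 𝔸ˣ}
    (hU₁ : U₁ ∈ {U₀ : Site d → Fin d → 𝔸ˣ | (∀ x κ, U₀ x κ ∈ unitaryUnits 𝔸) ∧
        Reg17 L m (fun _ => (Set.univ : Set (Site d))) (alphaQ d L / (L : ℝ) ^ 2) U₀})
    (hpos : ∀ A ∈ domSubH (𝔸 := 𝔸) (i.Ω 0), A ≠ 0 → 0 < bondPair τ A (deltaAOf i.η (opsAllZd τ L (cubeLamBP L a Mc ρ i.k) ops₀ M i m) U₁ A)) :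
    ∀ᶠ U₀ in 𝓝[{U₀ : Site d → Fin d → 𝔸ˣ | (∀ x κ, U₀ x κ ∈ unitaryUnits 𝔸) ∧
        Reg17 L m (fun _ => (Set.univ : Set (Site d))) (alphaQ d L / (L : ℝ) ^ 2) U₀}] U₁,
      ∀ A ∈ domSubH (𝔸 := 𝔸) (i.Ω 0), A ≠ 0 → 0 < bondPair τ A (deltaAOf i.η (opsAllZd τ L (cubeLamBP L a Mc ρ i.k) ops₀ M i m) U₀ A) := by
  have hstr := linear_herm_on_reg17UnivP τ hτt hτs hτp hL2 (cubeLamBP L a Mc ρ i.k) ops₀ M i m (cubeMember_Ω0_finite i hΩ)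
  exact bondPair_pos_eventually_domSubH τ (cubeMember_Ω0_finite i hΩ) hU₁ hstr.1
    (lettersContinuousWithinAt_opsAllZd_cube_reg17UnivP τ hτp hτt hτs hd2 hL2 (cubeLamBP L a Mc ρ i.k) ops₀ M i hΩ hΛs hρ hm hU₁) hpos

include hτp hτt hτs in
/-- ★★★ **… AND THEN `Δ_a(U₀)↾□₀` IS INVERTIBLE ON `E_𝔤(□₀)` FOR ALL `U₀ ∈ 𝒰′` NEAR `U₁`** (`G_𝔤(U₀)` exists there): positivity near `U₁` + dag-n06-w2 g3's
Hermiticity preservation on `𝒰′` + dag-n06-b's `regularAtH_of_bondPair_pos`. [cite: Balaban1985BackgroundPropagators, Thm 3.11 p.416, (3.27) p.395; Balaban1985RegularSpaces, (1.7) p.77] -/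
theorem regularAtH_eventually_of_pos_reg17UnivP [NeZero L] (hd2 : 2 ≤ d) (hL2 : 2 ≤ L) (ops₀ : ℝ → ZdIdx d L → ℕ → OpsZd d 𝔸) (M : ℝ)
    (i : ZdIdx d L) {a : Site d} {Mc ρ : ℕ} (hΩ : i.Ω = cubeFam false L a Mc ρ i.k) (hΛs : i.Λs = cubeLamS L a Mc ρ i.k) (hρ : L ≤ ρ)
    {m : ℕ} (hm : m ≤ i.k) {U₁ : Site d → Fin d → 𝔸ˣ}
    (hU₁ : U₁ ∈ {U₀ : Site d → Fin d → 𝔸ˣ | (∀ x κ, U₀ x κ ∈ unitaryUnits 𝔸) ∧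
        Reg17 L m (fun _ => (Set.univ : Set (Site d))) (alphaQ d L / (L : ℝ) ^ 2) U₀})
    (hpos : ∀ A ∈ domSubH (𝔸 := 𝔸) (i.Ω 0), A ≠ 0 → 0 < bondPair τ A (deltaAOf i.η (opsAllZd τ L (cubeLamBP L a Mc ρ i.k) ops₀ M i m) U₁ A)) :
    ∀ᶠ U₀ in 𝓝[{U₀ : Site d → Fin d → 𝔸ˣ | (∀ x κ, U₀ x κ ∈ unitaryUnits 𝔸) ∧
        Reg17 L m (fun _ => (Set.univ : Set (Site d))) (alphaQ d L / (L : ℝ) ^ 2) U₀}] U₁,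
      RegularAtH i.η (opsAllZd τ L (cubeLamBP L a Mc ρ i.k) ops₀ M i m) (i.Ω 0) U₀ := by
  have hstr := linear_herm_on_reg17UnivP τ hτt hτs hτp hL2 (cubeLamBP L a Mc ρ i.k) ops₀ M i m (cubeMember_Ω0_finite i hΩ)
  filter_upwards [bondPair_pos_eventually_of_pos_reg17UnivP τ hτp hτt hτs hd2 hL2 ops₀ M i hΩ hΛs hρ hm hU₁ hpos, eventually_mem_nhdsWithin]
    with U₀ hU₀pos hU₀
  exact regularAtH_of_bondPair_pos τ (cubeMember_Ω0_finite i hΩ) (hstr.1 U₀ hU₀) (hstr.2 U₀ hU₀) hU₀pos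

end Cube

end Literature.MathematicalPhysics.QuantumFieldTheory.Balaban1983to89.B9Thm311PosDefOpenRegimeZd

end
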